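/-
Copyright: the b2b-balaban T⁴-continuum CRUX team, row NE7b OWNER lineage `t4-ne7b-p1` (gen 118). Project licence.
-/
import Summits.QuantumFields.BalabanUV.T4Continuum.Spine.NE7b.SupTorusEffectiveActionGradient

/-!
# THE CONVEX BLOCK-SPIN STEP IS A SEMIGROUP ON `C¹` STRONGLY CONVEX ACTIONS: for ANY `C¹` function `S` on a finite carrier with a
# first-order letter of modulus `m > 0` (`S φ + DS(φ)(ψ − φ) + ½m·Σ(ψ − φ)² ≤ S ψ`) and ANY block map `Qt` with a right inverse
# `M` and block Jensen constant `vol`, the fibre minimum `W(w) = min_{Qt ψ = w} S ψ` is attained at exactly one fibre-critical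
# field `Φ w`, `W` is `C¹` with `∇W(w) = DS(Φ w)∘M`, and `W` HAS A FIRST-ORDER LETTER OF MODULUS `m·vol` — the class is CLOSED
# under the step, so the step ITERATES; and TWO STEPS ARE ONE STEP: `Φ₁ ∘ Φ₂` is the fibre-critical map of the composite block map
# `Q₂ ∘ Q₁` (modulus after two steps `m·vol₁·vol₂`).  The torus action of (92) is in the class with `m = min(2,a) − λ`
# (row NE7b, node U5c; (92) + (93) + TEA BY NAME; [folklore])

Cell `pub-balaban`, sub-cell `t4`, spine estimate NE7b (`T4WeightBudget.RelWeightBound`; the cell's OWN estimate — NOT PRINTED in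
[Bałaban 1983–89], NOT PROVED).  Crux-route work under `Spine/NE7b/` by the row OWNER (`t4-ne7b-p1` gen 118) under FREEZE (0)'s
crux-prover clause — the convex road's twin of the sup road's (76) `…SupBackgroundSemigroup` ∕ (80) `…SupBackgroundTower`; NOTHING
of Bałaban's is named as a Lean object, valued or asserted; no `T4Continuum/Support` leaf typed; no `def`, no notation (the class is a
pair of displayed hypotheses, the maps are quantified); zero `sorry`.  Imports (BY NAME): the OWNER's (96)
`…SupTorusEffectiveActionGradient` (through it (93) `exists_isMinOn_of_firstOrder` ∕ `norm_sq_le_sum_sq`, (92)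
`action_firstOrder_lower`, (89) `torus_form_coercive` ∕ `blockVolume_mul_sum_sq_blockAvg_le`, TEA `exists_clm_pair` ∕
`hasFDerivAt_action`, TDF `torus_operator_form_symm`).

WHY (located).  Every file of the convexity column ((92)–(107)) is stated for the sitewise action `½Σ φ·At φ + Σ v(φ x)`; the
effective action `W` it produces is NOT of that form (it is non-local in the block field), so the column as typed does not feed
itself.  What the first-order half of the column actually USES is only: `S` is differentiable everywhere and obeys the first-order
letter with a positive modulus.  That class is closed under the step — existence (the letter bounds sublevel sets), uniqueness and
minimality (the letter at a fibre-critical point loses its linear term on the fibre), the envelope gradient (squeeze between the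
letter and differentiability of `S` at ONE point along the shifted background), and the letter for `W` with modulus `m·vol` (block
Jensen on `Φ w′ − Φ w`, whose block means are `w′ − w`).  Fibre-criticality composes: `h = (h − M₁Q₁h) + M₁Q₁h`, the first part
killed at step one, the second read as `∇W₁` on `Q₁h ∈ ker Q₂` and killed at step two; uniqueness for `Q₂∘Q₁` identifies the maps.

WHAT IS PROVED ([folklore]):
* §1 (ANY finite carriers; the class `hS : HasFDerivAt S (S′ φ) φ`, `hfo : S φ + S′ φ (ψ − φ) + ½m·Σ(ψ − φ)² ≤ S ψ`)
  `line_hasDerivAt`, `fibre_lower_of_critical`, `isMinOn_of_critical`, `eq_of_critical`, `critical_of_isMinOn`,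
  **`existsUnique_fibreCritical`** (`m > 0`: exactly one fibre-critical field per fibre, and it minimises),
  **`hasFDerivAt_fibreMin`** (envelope: `HasFDerivAt (S ∘ Φ) ((S′(Φ w)).comp M) w`), **`fibreMin_firstOrder`** (the letter for
  `S ∘ Φ` with modulus `m·vol`), **`step_closure`** (assembled: the step maps the class `(ι, m)` into the class `(κ, m·vol)`).
* §2 **`semigroup`** (two block maps `Q₁ : ι → κ`, `Q₂ : κ → κ₂` with right inverses: if `Φ₁` is fibre-critical for `(S, Q₁)` and
  `Φ₂` for `(S ∘ Φ₁, Q₂)` then `Φ₁ ∘ Φ₂` is fibre-critical for `(S, Q₂ ∘ Q₁)`, hence equals ITS unique fibre-critical map and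
  minimises `S` on the composite fibres), `twoStep_firstOrder` (modulus `m·vol₁·vol₂`).
* §3 (the `Beta.Site` carriers) **`torus_action_mem_class`** (the torus action with `u′ ≥ −λ`, `λ ≤ min(2,a)` is in the class with
  `m = min(2,a) − λ` and `S′ = DS`), so §1–§2 apply to it and to every effective action it generates.
* §4 toy.

HONEST (what this is NOT).  First-order theory only (the Hessian ∕ `C²` half of the column needs the second derivative of `S`, which
the abstract class does not carry — (101)∕(102)∕(107) remain stated for the sitewise action); no locality, no constants beyond
`m·Π vol`; nothing about the measure (the true RG step integrates the fibre — (31)∕(95)); cubic periods; scalar skeleton, hard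
constraint ((A3), NC-NE7b-α UNRULED); nothing of Bałaban's.  BY-NAME EFFECT ON THE WALL: NONE.  NE7b NOT PRINTED ∕ NOT PROVED;
spine PROVED 0∕9; rung (B)+1 on a FINITE torus — NOT infinite volume, NOT the mass gap, NOT Clay.  HONEST DEPENDENCY: continuum YM on
T⁴ ⇐ BetaPertH ∧ nine spine estimates (0∕9 proved); BetaPertH ⇐ (D1) ∧ (D4) ∧ CAP+tail; G-an2-4 gates asym, D1 and NE2∕3∕4.
-/

set_option autoImplicit false

noncomputable section

namespace Summit.QuantumFields.BalabanUV.T4Continuum.NE7b.SupConvexStepSemigroup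

open Set Function Filter Asymptotics Metric
open scoped ENNReal Topology
open Literature.MathematicalPhysics.QuantumFieldTheory.Balaban1983to89
open B6QGQLower276 (X blk B side AX)
open B5Hk103ScalarZd (nbhd)
open Beta (Site siteOf windowMap)
open SupTorusDirichletForm (torus_operator_form_symm)
open SupTorusDirichletFormCoercive (torus_form_coercive)
open SupTorusEffectiveAction (exists_clm_pair hasFDerivAt_action)
open SupTorusActionConvex (action_firstOrder_lower)
open SupTorusActionMinimiser (exists_isMinOn_of_firstOrder norm_sq_le_sum_sq)

variable {d : ℕ}

/-! ## §1. The class and its closure under the step -/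

section Step

variable {ι κ : Type*} [Fintype ι] [Fintype κ]
  {S : (ι → ℝ) → ℝ} {S' : (ι → ℝ) → (ι → ℝ) →L[ℝ] ℝ} {m : ℝ}

omit [Fintype κ] in
/-- **THE FUNCTION ALONG A LINE**: `t ↦ S(φ + t•h)` has derivative `S′(φ + t•h) h`. [folklore] -/
theorem line_hasDerivAt (hS : ∀ φ, HasFDerivAt S (S' φ) φ) (φ h : ι → ℝ) (t : ℝ) :
    HasDerivAt (fun t : ℝ => S (φ + t • h)) (S' (φ + t • h) h) t := by
  have hline : HasDerivAt (fun t : ℝ => φ + t • h) ((1 : ℝ) • h) t := ((hasDerivAt_id t).smul_const h).const_add φ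
  have hc := (hS (φ + t • h)).comp_hasDerivAt t hline
  rw [one_smul] at hc
  exact hc

omit [Fintype κ] in
/-- **AT A FIBRE-CRITICAL POINT THE LETTER LOSES ITS LINEAR TERM ON THE FIBRE**: `S′ φ` kills `ker Qt`, `Qt ψ = Qt φ` ⟹
`S φ + ½m·Σ(ψ − φ)² ≤ S ψ`. [folklore] -/
theorem fibre_lower_of_critical (hfo : ∀ φ ψ : ι → ℝ, S φ + S' φ (ψ - φ) + m / 2 * ∑ x, (ψ x - φ x) ^ 2 ≤ S ψ)
    (Qt : (ι → ℝ) →L[ℝ] (κ → ℝ)) {φ ψ : ι → ℝ} (hcrit : ∀ h : ι → ℝ, Qt h = 0 → S' φ h = 0) (hQ : Qt ψ = Qt φ) :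
    S φ + m / 2 * ∑ x, (ψ x - φ x) ^ 2 ≤ S ψ := by
  have h := hfo φ ψ
  rw [hcrit (ψ - φ) (by rw [map_sub, hQ, sub_self]), add_zero] at h
  exact h

omit [Fintype κ] in
/-- **A FIBRE-CRITICAL POINT MINIMISES ON ITS FIBRE** (`0 ≤ m`). [folklore] -/
theorem isMinOn_of_critical (hfo : ∀ φ ψ : ι → ℝ, S φ + S' φ (ψ - φ) + m / 2 * ∑ x, (ψ x - φ x) ^ 2 ≤ S ψ) (hm : 0 ≤ m)
    (Qt : (ι → ℝ) →L[ℝ] (κ → ℝ)) {φ : ι → ℝ} (hcrit : ∀ h : ι → ℝ, Qt h = 0 → S' φ h = 0) :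
    IsMinOn S {ψ | Qt ψ = Qt φ} φ := by
  refine isMinOn_iff.2 fun ψ hψ => ?_
  have h := fibre_lower_of_critical hfo Qt hcrit hψ
  have hnn : 0 ≤ m / 2 * ∑ x, (ψ x - φ x) ^ 2 :=
    mul_nonneg (div_nonneg hm zero_le_two) (Finset.sum_nonneg fun x _ => sq_nonneg _)
  linarith

omit [Fintype κ] in
/-- **TWO FIBRE-CRITICAL POINTS ON ONE FIBRE COINCIDE** (`m > 0`). [folklore] -/
theorem eq_of_critical (hfo : ∀ φ ψ : ι → ℝ, S φ + S' φ (ψ - φ) + m / 2 * ∑ x, (ψ x - φ x) ^ 2 ≤ S ψ) (hm : 0 < m)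
    (Qt : (ι → ℝ) →L[ℝ] (κ → ℝ)) {φ ψ : ι → ℝ} (hQ : Qt ψ = Qt φ) (hcritφ : ∀ h : ι → ℝ, Qt h = 0 → S' φ h = 0)
    (hcritψ : ∀ h : ι → ℝ, Qt h = 0 → S' ψ h = 0) : φ = ψ := by
  have h1 := fibre_lower_of_critical hfo Qt hcritφ hQ
  have h2 := fibre_lower_of_critical hfo Qt hcritψ hQ.symm
  have hsymm : ∑ x, (φ x - ψ x) ^ 2 = ∑ x, (ψ x - φ x) ^ 2 := Finset.sum_congr rfl fun x _ => by ring
  rw [hsymm] at h2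
  have hle : m * ∑ x, (ψ x - φ x) ^ 2 ≤ 0 := by linarith
  have hzero : ∑ x, (ψ x - φ x) ^ 2 = 0 :=
    le_antisymm (nonpos_of_mul_nonpos_right hle hm) (Finset.sum_nonneg fun x _ => sq_nonneg _)
  funext x
  have hx := (Finset.sum_eq_zero_iff_of_nonneg fun x _ => sq_nonneg (ψ x - φ x)).1 hzero x (Finset.mem_univ x)
  rw [sq_eq_zero_iff, sub_eq_zero] at hx
  exact hx.symm

omit [Fintype κ] in
/-- **A FIBRE MINIMISER IS FIBRE-CRITICAL** (differentiate along `φ + t•h`, `h ∈ ker Qt`). [folklore] -/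
theorem critical_of_isMinOn (hS : ∀ φ, HasFDerivAt S (S' φ) φ) (Qt : (ι → ℝ) →L[ℝ] (κ → ℝ)) {φ : ι → ℝ}
    (hmin : IsMinOn S {ψ | Qt ψ = Qt φ} φ) (h : ι → ℝ) (hh : Qt h = 0) : S' φ h = 0 := by
  have hloc : IsLocalMin (fun t : ℝ => S (φ + t • h)) 0 := by
    refine Filter.Eventually.of_forall fun t => ?_
    have hmem : φ + t • h ∈ {ψ : ι → ℝ | Qt ψ = Qt φ} := by
      show Qt (φ + t • h) = Qt φ
      rw [map_add, map_smul, hh, smul_zero, add_zero]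
    simpa only [zero_smul, add_zero] using isMinOn_iff.1 hmin (φ + t • h) hmem
  have hder := hloc.hasDerivAt_eq_zero (line_hasDerivAt hS φ h 0)
  simpa only [zero_smul, add_zero] using hder

omit [Fintype κ] in
/-- **EXACTLY ONE FIBRE-CRITICAL FIELD PER FIBRE, AND IT MINIMISES** (`m > 0`; ANY `Qt`). [folklore] -/
theorem existsUnique_fibreCritical (hS : ∀ φ, HasFDerivAt S (S' φ) φ)
    (hfo : ∀ φ ψ : ι → ℝ, S φ + S' φ (ψ - φ) + m / 2 * ∑ x, (ψ x - φ x) ^ 2 ≤ S ψ) (hm : 0 < m)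
    (Qt : (ι → ℝ) →L[ℝ] (κ → ℝ)) (φ₀ : ι → ℝ) :
    (∃! φ : ι → ℝ, Qt φ = Qt φ₀ ∧ ∀ h : ι → ℝ, Qt h = 0 → S' φ h = 0) ∧
    ∀ φ : ι → ℝ, Qt φ = Qt φ₀ → (∀ h : ι → ℝ, Qt h = 0 → S' φ h = 0) → IsMinOn S {ψ | Qt ψ = Qt φ₀} φ := by
  have hcont : Continuous S := continuous_iff_continuousAt.2 fun φ => (hS φ).continuousAt
  have hF : IsClosed {ψ : ι → ℝ | Qt ψ = Qt φ₀} := isClosed_eq Qt.continuous continuous_const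
  obtain ⟨φ, hφ, hmin⟩ := exists_isMinOn_of_firstOrder hcont hF (show φ₀ ∈ {ψ : ι → ℝ | Qt ψ = Qt φ₀} from rfl) hm
    (L := S' φ₀) (fun ψ _ => hfo φ₀ ψ)
  have hmin' : IsMinOn S {ψ | Qt ψ = Qt φ} φ := by rw [show Qt φ = Qt φ₀ from hφ]; exact hmin
  have hcrit := critical_of_isMinOn hS Qt hmin'
  refine ⟨⟨φ, ⟨hφ, hcrit⟩, fun ψ hψ => ?_⟩, fun ψ hψQ hψcrit => ?_⟩
  · exact (eq_of_critical hfo hm Qt (hφ.trans hψ.1.symm) hψ.2 hcrit)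
  · have heq : φ = ψ := eq_of_critical hfo hm Qt (hψQ.trans hφ.symm) hcrit hψcrit
    rw [← heq]; exact hmin

/-- **THE ENVELOPE THEOREM**: `0 ≤ m`; `Qt` with a continuous linear right inverse `M`; `Φ` ANY map with `Qt(Φ w) = w` whose values
are fibre-critical.  Then `HasFDerivAt (S ∘ Φ) ((S′(Φ w)).comp M) w` at EVERY `w` — no derivative of `Φ`. [folklore] -/
theorem hasFDerivAt_fibreMin (hS : ∀ φ, HasFDerivAt S (S' φ) φ)
    (hfo : ∀ φ ψ : ι → ℝ, S φ + S' φ (ψ - φ) + m / 2 * ∑ x, (ψ x - φ x) ^ 2 ≤ S ψ) (hm : 0 ≤ m)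
    (Qt : (ι → ℝ) →L[ℝ] (κ → ℝ)) (M : (κ → ℝ) →L[ℝ] (ι → ℝ)) (hM : ∀ k : κ → ℝ, Qt (M k) = k)
    (Φ : (κ → ℝ) → (ι → ℝ)) (hΦQ : ∀ w, Qt (Φ w) = w) (hΦcrit : ∀ (w : κ → ℝ) (h : ι → ℝ), Qt h = 0 → S' (Φ w) h = 0)
    (w : κ → ℝ) : HasFDerivAt (fun w' : κ → ℝ => S (Φ w')) ((S' (Φ w)).comp M) w := by
  -- the action along the shifted background
  have haff : HasFDerivAt (fun w' : κ → ℝ => Φ w + (M w' - M w)) M w :=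
    ((M.hasFDerivAt).sub_const (M w)).const_add (Φ w)
  have hg : HasFDerivAt (fun w' : κ → ℝ => S (Φ w + (M w' - M w))) ((S' (Φ w)).comp M) w := by
    have hS' : HasFDerivAt S (S' (Φ w)) (Φ w + (M w - M w)) := by rw [sub_self, add_zero]; exact hS (Φ w)
    exact hS'.comp w haff
  have hupper : ∀ w' : κ → ℝ, S (Φ w') ≤ S (Φ w + (M w' - M w)) := fun w' => by
    refine isMinOn_iff.1 (isMinOn_of_critical hfo hm Qt (hΦcrit w')) (Φ w + (M w' - M w)) ?_
    show Qt (Φ w + (M w' - M w)) = Qt (Φ w')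
    rw [map_add Qt, map_sub Qt, hM, hM, hΦQ, hΦQ]; abel
  have hlower : ∀ w' : κ → ℝ, S (Φ w) + S' (Φ w) (M (w' - w)) ≤ S (Φ w') := fun w' => by
    have h1 := hfo (Φ w) (Φ w')
    have hker : Qt (Φ w' - Φ w - M (w' - w)) = 0 := by rw [map_sub Qt, map_sub Qt, hΦQ, hΦQ, hM]; abel
    have hkill := hΦcrit w _ hker
    rw [map_sub] at hkill
    rw [sub_eq_zero.1 hkill] at h1
    have hnn : 0 ≤ m / 2 * ∑ x, (Φ w' x - Φ w x) ^ 2 :=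
      mul_nonneg (div_nonneg hm zero_le_two) (Finset.sum_nonneg fun x _ => sq_nonneg _)
    linarith
  rw [hasFDerivAt_iff_isLittleO_nhds_zero] at hg ⊢
  refine IsBigO.trans_isLittleO (IsBigO.of_bound 1 (Eventually.of_forall fun k => ?_)) hg
  have hF0 : 0 ≤ S (Φ (w + k)) - S (Φ w) - ((S' (Φ w)).comp M) k := by
    have hl := hlower (w + k)
    rw [add_sub_cancel_left] at hl
    rw [ContinuousLinearMap.comp_apply]
    linarith
  have hFG : S (Φ (w + k)) - S (Φ w) - ((S' (Φ w)).comp M) k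
      ≤ S (Φ w + (M (w + k) - M w)) - S (Φ w + (M w - M w)) - ((S' (Φ w)).comp M) k := by
    have hu1 := hupper (w + k)
    simp only [sub_self, add_zero]
    linarith
  rw [Real.norm_eq_abs, Real.norm_eq_abs, abs_of_nonneg hF0, one_mul]
  exact hFG.trans (le_abs_self _)

/-- **THE FIRST-ORDER LETTER OF THE FIBRE MINIMUM, MODULUS `m·vol`**: with the block Jensen letter `vol·Σ_y (Qt h)² ≤ Σ_x h²`
and `0 ≤ m`, for every `w, w′`: `S(Φ w) + (S′(Φ w)∘M)(w′ − w) + ½(m·vol)·Σ_y (w′ − w)² ≤ S(Φ w′)`. [folklore] -/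
theorem fibreMin_firstOrder (hfo : ∀ φ ψ : ι → ℝ, S φ + S' φ (ψ - φ) + m / 2 * ∑ x, (ψ x - φ x) ^ 2 ≤ S ψ) (hm : 0 ≤ m)
    (Qt : (ι → ℝ) →L[ℝ] (κ → ℝ)) (M : (κ → ℝ) →L[ℝ] (ι → ℝ)) (hM : ∀ k : κ → ℝ, Qt (M k) = k) {vol : ℝ}
    (hJ : ∀ h : ι → ℝ, vol * ∑ y, Qt h y ^ 2 ≤ ∑ x, h x ^ 2)
    (Φ : (κ → ℝ) → (ι → ℝ)) (hΦQ : ∀ w, Qt (Φ w) = w) (hΦcrit : ∀ (w : κ → ℝ) (h : ι → ℝ), Qt h = 0 → S' (Φ w) h = 0)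
    (w w' : κ → ℝ) :
    S (Φ w) + ((S' (Φ w)).comp M) (w' - w) + m * vol / 2 * ∑ y, (w' y - w y) ^ 2 ≤ S (Φ w') := by
  have h1 := hfo (Φ w) (Φ w')
  have hker : Qt (Φ w' - Φ w - M (w' - w)) = 0 := by rw [map_sub Qt, map_sub Qt, hΦQ, hΦQ, hM]; abel
  have hkill := hΦcrit w _ hker
  rw [map_sub] at hkill
  rw [sub_eq_zero.1 hkill] at h1
  have hJ' : vol * ∑ y, (w' y - w y) ^ 2 ≤ ∑ x, (Φ w' x - Φ w x) ^ 2 := by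
    have h2 := hJ (Φ w' - Φ w)
    rw [map_sub, hΦQ, hΦQ] at h2
    simpa only [Pi.sub_apply] using h2
  have h3 : m * vol / 2 * ∑ y, (w' y - w y) ^ 2 ≤ m / 2 * ∑ x, (Φ w' x - Φ w x) ^ 2 := by
    have := mul_le_mul_of_nonneg_left hJ' (div_nonneg hm zero_le_two)
    linarith
  rw [ContinuousLinearMap.comp_apply]
  linarith

/-- **STEP CLOSURE, ASSEMBLED**: `m > 0`, `Qt` with right inverse `M` and block Jensen constant `vol`.  There is a map `Φ` with
`Qt(Φ w) = w`, fibre-critical and minimising values, UNIQUE among such maps, such that `W = S ∘ Φ` has `HasFDerivAt W ((S′(Φ w))∘M) w`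
everywhere and the first-order letter with modulus `m·vol` — the pair `(W, w ↦ (S′(Φ w))∘M)` is again in the class. [folklore] -/
theorem step_closure (hS : ∀ φ, HasFDerivAt S (S' φ) φ)
    (hfo : ∀ φ ψ : ι → ℝ, S φ + S' φ (ψ - φ) + m / 2 * ∑ x, (ψ x - φ x) ^ 2 ≤ S ψ) (hm : 0 < m)
    (Qt : (ι → ℝ) →L[ℝ] (κ → ℝ)) (M : (κ → ℝ) →L[ℝ] (ι → ℝ)) (hM : ∀ k : κ → ℝ, Qt (M k) = k) {vol : ℝ}
    (hJ : ∀ h : ι → ℝ, vol * ∑ y, Qt h y ^ 2 ≤ ∑ x, h x ^ 2) :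
    ∃ Φ : (κ → ℝ) → (ι → ℝ),
      (∀ w, Qt (Φ w) = w) ∧ (∀ (w : κ → ℝ) (h : ι → ℝ), Qt h = 0 → S' (Φ w) h = 0) ∧
      (∀ w, IsMinOn S {ψ | Qt ψ = w} (Φ w)) ∧
      (∀ Ψ : (κ → ℝ) → (ι → ℝ), (∀ w, Qt (Ψ w) = w) → (∀ (w : κ → ℝ) (h : ι → ℝ), Qt h = 0 → S' (Ψ w) h = 0) → Ψ = Φ) ∧
      (∀ w, HasFDerivAt (fun w' : κ → ℝ => S (Φ w')) ((S' (Φ w)).comp M) w) ∧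
      ∀ w w' : κ → ℝ, S (Φ w) + ((S' (Φ w)).comp M) (w' - w) + m * vol / 2 * ∑ y, (w' y - w y) ^ 2 ≤ S (Φ w') := by
  choose Φ hΦ using fun w : κ → ℝ => (existsUnique_fibreCritical hS hfo hm Qt (M w)).1.exists
  have hΦQ : ∀ w, Qt (Φ w) = w := fun w => (hΦ w).1.trans (hM w)
  have hΦcrit : ∀ (w : κ → ℝ) (h : ι → ℝ), Qt h = 0 → S' (Φ w) h = 0 := fun w => (hΦ w).2
  refine ⟨Φ, hΦQ, hΦcrit, fun w => ?_, fun Ψ hΨQ hΨcrit => funext fun w => ?_,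
    hasFDerivAt_fibreMin hS hfo hm.le Qt M hM Φ hΦQ hΦcrit, fibreMin_firstOrder hfo hm.le Qt M hM hJ Φ hΦQ hΦcrit⟩
  · have := isMinOn_of_critical hfo hm.le Qt (hΦcrit w)
    rwa [hΦQ] at this
  · exact eq_of_critical hfo hm Qt ((hΦQ w).trans (hΨQ w).symm) (hΨcrit w) (hΦcrit w)

end Step

/-! ## §2. Two steps are one step -/

section Semigroup

variable {ι κ κ₂ : Type*} [Fintype ι] [Fintype κ] [Fintype κ₂]
  {S : (ι → ℝ) → ℝ} {S' : (ι → ℝ) → (ι → ℝ) →L[ℝ] ℝ} {m : ℝ}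

omit [Fintype ι] [Fintype κ] [Fintype κ₂] in
/-- **FIBRE-CRITICALITY COMPOSES**: `Φ₁` fibre-critical for `(S′, Q₁)` with `Q₁(Φ₁ w) = w`, `M₁` a right inverse of `Q₁`, and `Φ₂`
fibre-critical for `(w ↦ (S′(Φ₁ w))∘M₁, Q₂)` ⟹ `Φ₁ ∘ Φ₂` is fibre-critical for `(S′, Q₂ ∘ Q₁)`. [folklore] -/
theorem comp_critical (Q₁ : (ι → ℝ) →L[ℝ] (κ → ℝ)) (M₁ : (κ → ℝ) →L[ℝ] (ι → ℝ)) (hM₁ : ∀ k : κ → ℝ, Q₁ (M₁ k) = k)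
    (Q₂ : (κ → ℝ) →L[ℝ] (κ₂ → ℝ)) {Φ₁ : (κ → ℝ) → (ι → ℝ)}
    (hΦ₁crit : ∀ (w : κ → ℝ) (h : ι → ℝ), Q₁ h = 0 → S' (Φ₁ w) h = 0) {Φ₂ : (κ₂ → ℝ) → (κ → ℝ)}
    (hΦ₂crit : ∀ (w₂ : κ₂ → ℝ) (k : κ → ℝ), Q₂ k = 0 → ((S' (Φ₁ (Φ₂ w₂))).comp M₁) k = 0)
    (w₂ : κ₂ → ℝ) (h : ι → ℝ) (hh : (Q₂.comp Q₁) h = 0) : S' (Φ₁ (Φ₂ w₂)) h = 0 := by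
  have hsplit : h = (h - M₁ (Q₁ h)) + M₁ (Q₁ h) := by abel
  have h1 : S' (Φ₁ (Φ₂ w₂)) (h - M₁ (Q₁ h)) = 0 :=
    hΦ₁crit (Φ₂ w₂) _ (by rw [map_sub, hM₁, sub_self])
  have h2 : S' (Φ₁ (Φ₂ w₂)) (M₁ (Q₁ h)) = 0 := by
    have := hΦ₂crit w₂ (Q₁ h) (by simpa only [ContinuousLinearMap.comp_apply] using hh)
    rwa [ContinuousLinearMap.comp_apply] at this
  rw [hsplit, map_add, h1, h2, add_zero]

omit [Fintype κ] [Fintype κ₂] in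
/-- **THE SEMIGROUP PROPERTY**: `m > 0`; block maps `Q₁ : ι → κ`, `Q₂ : κ → κ₂` with right inverses `M₁, M₂`; `Φ₁` fibre-critical for
`(S, Q₁)` with `Q₁(Φ₁ w) = w`; `Φ₂` fibre-critical for the effective action `(S ∘ Φ₁, (S′∘Φ₁)∘M₁, Q₂)` with `Q₂(Φ₂ w₂) = w₂`; `Φ₁₂` the
fibre-critical map of `(S, Q₂ ∘ Q₁)`.  Then `Φ₁ ∘ Φ₂ = Φ₁₂`, and `Φ₁(Φ₂ w₂)` minimises `S` on the composite fibre
`{ψ | Q₂(Q₁ ψ) = w₂}`: TWO BLOCK-SPIN STEPS ARE ONE STEP WITH THE COMPOSITE BLOCK MAP. [folklore] -/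
theorem semigroup (hfo : ∀ φ ψ : ι → ℝ, S φ + S' φ (ψ - φ) + m / 2 * ∑ x, (ψ x - φ x) ^ 2 ≤ S ψ) (hm : 0 < m)
    (Q₁ : (ι → ℝ) →L[ℝ] (κ → ℝ)) (M₁ : (κ → ℝ) →L[ℝ] (ι → ℝ)) (hM₁ : ∀ k : κ → ℝ, Q₁ (M₁ k) = k)
    (Q₂ : (κ → ℝ) →L[ℝ] (κ₂ → ℝ)) {Φ₁ : (κ → ℝ) → (ι → ℝ)} (hΦ₁Q : ∀ w, Q₁ (Φ₁ w) = w)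
    (hΦ₁crit : ∀ (w : κ → ℝ) (h : ι → ℝ), Q₁ h = 0 → S' (Φ₁ w) h = 0) {Φ₂ : (κ₂ → ℝ) → (κ → ℝ)}
    (hΦ₂Q : ∀ w₂, Q₂ (Φ₂ w₂) = w₂)
    (hΦ₂crit : ∀ (w₂ : κ₂ → ℝ) (k : κ → ℝ), Q₂ k = 0 → ((S' (Φ₁ (Φ₂ w₂))).comp M₁) k = 0)
    {Φ₁₂ : (κ₂ → ℝ) → (ι → ℝ)} (hΦ₁₂Q : ∀ w₂, (Q₂.comp Q₁) (Φ₁₂ w₂) = w₂)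
    (hΦ₁₂crit : ∀ (w₂ : κ₂ → ℝ) (h : ι → ℝ), (Q₂.comp Q₁) h = 0 → S' (Φ₁₂ w₂) h = 0) :
    (∀ w₂, Φ₁ (Φ₂ w₂) = Φ₁₂ w₂) ∧ ∀ w₂, IsMinOn S {ψ | (Q₂.comp Q₁) ψ = w₂} (Φ₁ (Φ₂ w₂)) := by
  have hcQ : ∀ w₂, (Q₂.comp Q₁) (Φ₁ (Φ₂ w₂)) = w₂ := fun w₂ => by
    rw [ContinuousLinearMap.comp_apply, hΦ₁Q, hΦ₂Q]
  have hccrit := comp_critical Q₁ M₁ hM₁ Q₂ hΦ₁crit hΦ₂crit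
  refine ⟨fun w₂ => eq_of_critical hfo hm (Q₂.comp Q₁) ((hΦ₁₂Q w₂).trans (hcQ w₂).symm) (hccrit w₂) (hΦ₁₂crit w₂),
    fun w₂ => ?_⟩
  have := isMinOn_of_critical hfo hm.le (Q₂.comp Q₁) (hccrit w₂)
  rwa [hcQ] at this

/-- **TWO STEPS: MODULUS `m·vol₁·vol₂`** — the first-order letter of `S ∘ Φ₁ ∘ Φ₂` with derivative `((S′(Φ₁(Φ₂ w₂)))∘M₁)∘M₂`.
[folklore] -/
theorem twoStep_firstOrder (hfo : ∀ φ ψ : ι → ℝ, S φ + S' φ (ψ - φ) + m / 2 * ∑ x, (ψ x - φ x) ^ 2 ≤ S ψ) (hm : 0 ≤ m)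
    (Q₁ : (ι → ℝ) →L[ℝ] (κ → ℝ)) (M₁ : (κ → ℝ) →L[ℝ] (ι → ℝ)) (hM₁ : ∀ k : κ → ℝ, Q₁ (M₁ k) = k) {vol₁ : ℝ}
    (hvol₁ : 0 ≤ vol₁) (hJ₁ : ∀ h : ι → ℝ, vol₁ * ∑ y, Q₁ h y ^ 2 ≤ ∑ x, h x ^ 2)
    (Q₂ : (κ → ℝ) →L[ℝ] (κ₂ → ℝ)) (M₂ : (κ₂ → ℝ) →L[ℝ] (κ → ℝ)) (hM₂ : ∀ k : κ₂ → ℝ, Q₂ (M₂ k) = k) {vol₂ : ℝ}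
    (hJ₂ : ∀ k : κ → ℝ, vol₂ * ∑ z, Q₂ k z ^ 2 ≤ ∑ y, k y ^ 2)
    {Φ₁ : (κ → ℝ) → (ι → ℝ)} (hΦ₁Q : ∀ w, Q₁ (Φ₁ w) = w)
    (hΦ₁crit : ∀ (w : κ → ℝ) (h : ι → ℝ), Q₁ h = 0 → S' (Φ₁ w) h = 0) {Φ₂ : (κ₂ → ℝ) → (κ → ℝ)}
    (hΦ₂Q : ∀ w₂, Q₂ (Φ₂ w₂) = w₂)
    (hΦ₂crit : ∀ (w₂ : κ₂ → ℝ) (k : κ → ℝ), Q₂ k = 0 → ((S' (Φ₁ (Φ₂ w₂))).comp M₁) k = 0) (w₂ w₂' : κ₂ → ℝ) :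
    S (Φ₁ (Φ₂ w₂)) + (((S' (Φ₁ (Φ₂ w₂))).comp M₁).comp M₂) (w₂' - w₂)
        + m * vol₁ * vol₂ / 2 * ∑ z, (w₂' z - w₂ z) ^ 2 ≤ S (Φ₁ (Φ₂ w₂')) := by
  -- the one-step letter for `W₁ = S ∘ Φ₁` (modulus `m·vol₁`), then the step lemma applied to `W₁`
  have hW₁ : ∀ w w' : κ → ℝ, S (Φ₁ w) + ((S' (Φ₁ w)).comp M₁) (w' - w) + m * vol₁ / 2 * ∑ y, (w' y - w y) ^ 2 ≤ S (Φ₁ w') :=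
    fibreMin_firstOrder hfo hm Q₁ M₁ hM₁ hJ₁ Φ₁ hΦ₁Q hΦ₁crit
  have h := fibreMin_firstOrder (S := fun w : κ → ℝ => S (Φ₁ w)) (S' := fun w => (S' (Φ₁ w)).comp M₁) (m := m * vol₁) hW₁
    (mul_nonneg hm hvol₁) Q₂ M₂ hM₂ hJ₂ Φ₂ hΦ₂Q hΦ₂crit w₂ w₂'
  simpa only [mul_assoc] using h

end Semigroup

/-! ## §3. The torus action is in the class -/

section Torus

variable (n : ℕ) (a : ℝ) (s : ℕ) [NeZero s]
  {Aop : lp (fun _ : X d => ℝ) ∞ →L[ℝ] lp (fun _ : X d => ℝ) ∞}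
  (hA : ∀ (f : lp (fun _ : X d => ℝ) ∞) (p : X d), Aop f p = ∑ r ∈ nbhd n p, AX n a p r * f r)
  {v u u' : ℝ → ℝ} (hv : ∀ t, HasDerivAt v (u t) t) (hu : ∀ t, HasDerivAt u (u' t) t)
  {lam : ℝ} (hu' : ∀ t, -lam ≤ u' t)
  {Ef : (Site d ((n + 1) * s) → ℝ) →L[ℝ] lp (fun _ : X d => ℝ) ∞}
  (hEf : ∀ (g : Site d ((n + 1) * s) → ℝ) (q : X d), Ef g q = g (siteOf d ((n + 1) * s) q))
  {Rf : lp (fun _ : X d => ℝ) ∞ →L[ℝ] (Site d ((n + 1) * s) → ℝ)}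
  (hRf : ∀ (h : lp (fun _ : X d => ℝ) ∞) (x : Site d ((n + 1) * s)), Rf h x = h (windowMap d ((n + 1) * s) x))

include hA hv hu hu' hEf hRf in
/-- **THE TORUS ACTION IS IN THE CLASS WITH `m = min(2,a) − λ`**: `At = Rf∘Aop∘Ef`, `v′ = u`, `u′` a derivative of `u` with
`u′ ≥ −λ` on `ℝ`: with `S′ := fderiv S`, `HasFDerivAt S (S′ φ) φ` everywhere and
`S φ + S′ φ (ψ − φ) + ½(min(2,a) − λ)·Σ(ψ − φ)² ≤ S ψ` — so §1–§2 apply to the torus action and to every effective action it generates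
along any tower of block maps. [folklore] -/
theorem torus_action_mem_class :
    (∀ φ : Site d ((n + 1) * s) → ℝ,
      HasFDerivAt (fun φ : Site d ((n + 1) * s) → ℝ => (1 / 2 : ℝ) * ∑ x, φ x * ((Rf.comp Aop).comp Ef) φ x + ∑ x, v (φ x))
        (fderiv ℝ (fun φ : Site d ((n + 1) * s) → ℝ =>
          (1 / 2 : ℝ) * ∑ x, φ x * ((Rf.comp Aop).comp Ef) φ x + ∑ x, v (φ x)) φ) φ) ∧
    ∀ φ ψ : Site d ((n + 1) * s) → ℝ,
      ((1 / 2 : ℝ) * ∑ x, φ x * ((Rf.comp Aop).comp Ef) φ x + ∑ x, v (φ x))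
        + fderiv ℝ (fun φ : Site d ((n + 1) * s) → ℝ =>
            (1 / 2 : ℝ) * ∑ x, φ x * ((Rf.comp Aop).comp Ef) φ x + ∑ x, v (φ x)) φ (ψ - φ)
        + (min 2 a - lam) / 2 * ∑ x, (ψ x - φ x) ^ 2
      ≤ (1 / 2 : ℝ) * ∑ x, ψ x * ((Rf.comp Aop).comp Ef) ψ x + ∑ x, v (ψ x) := by
  have hsymm := torus_operator_form_symm n a s hA hEf hRf
  refine ⟨fun φ => ?_, fun φ ψ => action_firstOrder_lower ((Rf.comp Aop).comp Ef) hsymm (torus_form_coercive n a s hA hEf hRf)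
    hv hu hu' φ ψ⟩
  obtain ⟨L, hL⟩ := exists_clm_pair (fun x => ((Rf.comp Aop).comp Ef) φ x + u (φ x))
  exact (hasFDerivAt_action ((Rf.comp Aop).comp Ef) hsymm hv φ hL).differentiableAt.hasFDerivAt

end Torus

/-! ## §4. Toy -/

/-- Toy (§1 `step_closure` with `S φ = Σ φ²` on one site, `S′ φ = 2⟨φ, –⟩` packaged by `fderiv`, modulus `2`, `Qt = M = 1`,
`vol = 1`): the step produces a fibre-critical map. -/
example : ∃ Φ : (Unit → ℝ) → (Unit → ℝ), (∀ w, (ContinuousLinearMap.id ℝ (Unit → ℝ)) (Φ w) = w) ∧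
    (∀ (w : Unit → ℝ) (h : Unit → ℝ), (ContinuousLinearMap.id ℝ (Unit → ℝ)) h = 0 →
      fderiv ℝ (fun φ : Unit → ℝ => ∑ x, φ x ^ 2) (Φ w) h = 0) ∧
    (∀ w, IsMinOn (fun φ : Unit → ℝ => ∑ x, φ x ^ 2) {ψ | (ContinuousLinearMap.id ℝ (Unit → ℝ)) ψ = w} (Φ w)) ∧
    (∀ Ψ : (Unit → ℝ) → (Unit → ℝ), (∀ w, (ContinuousLinearMap.id ℝ (Unit → ℝ)) (Ψ w) = w) →
      (∀ (w : Unit → ℝ) (h : Unit → ℝ), (ContinuousLinearMap.id ℝ (Unit → ℝ)) h = 0 →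
        fderiv ℝ (fun φ : Unit → ℝ => ∑ x, φ x ^ 2) (Ψ w) h = 0) → Ψ = Φ) ∧
    (∀ w, HasFDerivAt (fun w' : Unit → ℝ => ∑ x, Φ w' x ^ 2)
      ((fderiv ℝ (fun φ : Unit → ℝ => ∑ x, φ x ^ 2) (Φ w)).comp (ContinuousLinearMap.id ℝ (Unit → ℝ))) w) ∧
    ∀ w w' : Unit → ℝ, ∑ x, Φ w x ^ 2 + ((fderiv ℝ (fun φ : Unit → ℝ => ∑ x, φ x ^ 2) (Φ w)).comp
      (ContinuousLinearMap.id ℝ (Unit → ℝ))) (w' - w) + 2 * 1 / 2 * ∑ y, (w' y - w y) ^ 2 ≤ ∑ x, Φ w' x ^ 2 := by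
  have hd : ∀ φ : Unit → ℝ, HasFDerivAt (fun φ : Unit → ℝ => ∑ x, φ x ^ 2)
      ((2 * φ ()) • ContinuousLinearMap.proj (R := ℝ) (φ := fun _ : Unit => ℝ) ()) φ := by
    intro φ
    have h1 : (fun φ : Unit → ℝ => ∑ x, φ x ^ 2) = fun φ => φ () ^ 2 := by funext φ; simp
    rw [h1]
    have h2 := ((ContinuousLinearMap.proj (R := ℝ) (φ := fun _ : Unit => ℝ) ()).hasFDerivAt (x := φ)).pow 2
    simpa using h2
  have hS : ∀ φ : Unit → ℝ, HasFDerivAt (fun φ : Unit → ℝ => ∑ x, φ x ^ 2) (fderiv ℝ (fun φ : Unit → ℝ => ∑ x, φ x ^ 2) φ) φ :=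
    fun φ => (hd φ).differentiableAt.hasFDerivAt
  refine step_closure (m := 2) hS (fun φ ψ => ?_) two_pos (ContinuousLinearMap.id ℝ (Unit → ℝ))
    (ContinuousLinearMap.id ℝ (Unit → ℝ)) (fun _ => rfl) (vol := 1) (fun h => by simp)
  rw [(hd φ).fderiv]
  simp only [Finset.univ_unique, PUnit.default_eq_unit, Finset.sum_singleton, smul_apply,
    ContinuousLinearMap.proj_apply, Pi.sub_apply, smul_eq_mul]
  nlinarith [sq_nonneg (ψ () - φ ())]

end Summit.QuantumFields.BalabanUV.T4Continuum.NE7b.SupConvexStepSemigroup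

end
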